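import Summits.Langlands.Langlands.Theses.HolomorphicShadow
import HarnessLib

/-!
# `HolomorphicShadow.EvenArtinFromShadows` (stmt-Langlands-14114) — the slice glue, proved

[proof of `Summit.Langlands.Langlands.Theses.HolomorphicShadow.EvenArtinFromShadows`
(route `HolomorphicShadow`, support item, rank 9): `ShadowModularity → ShadowConverse →
MaassEigenformStrongArtin → EvenArtinShadowData → EvenStrongArtinSC`]

Pure logic — the body of the route's deciding theorem `closes` up to its last step, threaded through
the two dictionaries, so that an ITEM of the route concludes the target `EvenStrongArtinSC` (even
strong Artin over `ℚ`, a.e.-Satake form) BY NAME.  Fix `σ` irreducible and even;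
`EvenArtinShadowData` gives the pinned datum `(N, χ, ε, a)` (parity pin, polynomial growth, Euler
pin); `ShadowModularity` gives a good level `L₀` (`N ∣ L₀`) at which all holomorphic shadows of weight
`k ≥ 4` against cusp forms of trivial nebentypus are cusp forms of character `χ`; `ShadowConverse` at
`(N, L₀, χ, ψ = 1, k₀ = 4)` returns the `Γ₀(L₀)`-automorphy of the Maass form `φ_{(a,ε)}` with
character `χ`; `MaassEigenformStrongArtin` turns that into the cuspidal `P` with a.e. Satake–Frobenius
matching.  No Literature named fact is consumed; axioms `propext`, `Classical.choice`, `Quot.sound`. -/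

set_option linter.dupNamespace false

namespace Summit.Langlands.Langlands.Theorems.HolomorphicShadowEvenArtinFromShadows

open Summit.Langlands.Langlands.Theses.HolomorphicShadow

/-- **stmt-Langlands-14114** `HolomorphicShadow.EvenArtinFromShadows`: shadows ⇒ even strong Artin
(a.e.-Satake form), by chaining the datum, the shadow modularity, the converse theorem at
`(N, L₀, χ, 1, 4)` and the Maass-eigenform dictionary. -/
theorem evenArtinFromShadows : EvenArtinFromShadows := by
  intro hSM hSC hMaass hData σ hirr heven
  obtain ⟨N, χ, ε, a, hN, hε, hpar, hgrowth, hpin⟩ := hData σ hirr heven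
  obtain ⟨L₀, hL₀, hNL₀, hmod⟩ := hSM σ hirr N χ ε a hN hε hpar hpin
  exact hMaass σ hirr N L₀ χ ε a hN hNL₀ hL₀ hε hgrowth hpin
    (hSC N L₀ χ (1 : DirichletCharacter ℂ L₀) ε a 4 hN hNL₀ hL₀ hε hgrowth
      (fun k hk b g hg => hmod k hk L₀ (dvd_refl L₀) hL₀ 1 b g hg))

end Summit.Langlands.Langlands.Theorems.HolomorphicShadowEvenArtinFromShadows
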